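import Summits.NavierStokesRegularity.NavierStokesRegularity.Theorems.SymmetryModuliCountForcedSymmetryStubSatelliteExclusionNearIdentityRotZ
import Summits.NavierStokesRegularity.NavierStokesRegularity.Theorems.RellichScarSimilarityCovariance
import Literature.Analysis.FluidPDE.IsometryInvariance
import HarnessLib

/-!
# Crux `ForcedSymmetry` (stmt-NavierStokesRegularity-4052), line `recurrent-closing` gen 5, stub 3a
# `stub_satelliteExclusion`: the near-identity range with slow rotation about an ARBITRARY axis

Support file (theorems only, `--supports stmt-NavierStokesRegularity-4052`).  The `e₃`-axis statement
`satelliteExclusion_nearIdentity_rotZ` (p143431) conjugated by a linear isometry `Q` of `ℝ³` (rotation covariance of the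
Albritton–Barker class: `isSuitableWeakSolutionOn_conj`, `hasWeakSpatialGradientOn_conj`, `typeIBound_lowerHalf_conj`,
`IsClassicalNSSolutionOn.conj_linearIsometryEquiv`; transport of `L^∞` norms on final-slice cylinders,
`eLpNorm_top_parabolicCylinder_conj`): for every `C`, `M < ⊤` there are `Λ > 1`, `α₁ > 0` such that a classical slab profile of
the class (`𝐈 ≤ M`, rate `C`) invariant a.e. under `(t,x) ↦ l R⁻¹ w(l²t, l R x + ξ)` with the rotation
`R = Q R_θ Q⁻¹` (angle `θ` about the axis `Q e₃`), `1 < l < Λ`, `|θ| ≤ α₁ log l`, any `ξ`, is regular at every point of the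
final slice.  Every rotation of `ℝ³` has this form, so this is the full near-identity slowly-rotating range of stubs 3a/3c
(and of crux stmt-8561) for proper rotations.

References: D. Chae, J. Wolf, arXiv:1610.09464, Thms 1.1, 1.3 [ChaeWolf2017RemovingDSS]; B. Pineau, V. Vicol, arXiv:2607.09619,
Thm 1.7 (i) [PineauVicol2026]; A. Majda, A. Bertozzi, CUP 2002, Prop. 1.1 (iii) [MajdaBertozziCUP2002].
-/

noncomputable section

-- the summit and its single sub-problem share the name (CONVENTIONS §1), as in every Theorems file
set_option linter.dupNamespace false

open MeasureTheory Set Function Metric Filter Topology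
open scoped ENNReal NNReal
open Literature.Analysis.FluidPDE
open Summit.NavierStokesRegularity.NavierStokesRegularity.Theorems.RellichScarSimilarityCovariance

namespace Summit.NavierStokesRegularity.NavierStokesRegularity.Theorems.SymmetryModuliCountForcedSymmetry

/-- The Type-I RATE is invariant under conjugation by a linear isometry (`‖Q⁻¹ a‖ = ‖a‖`). [folklore] -/
theorem hasTypeITimeDecay_conj_symm {C : ℝ} {w : ℝ → EuclideanSpace ℝ (Fin 3) → EuclideanSpace ℝ (Fin 3)}
    (h : HasTypeITimeDecay C w) (Q : EuclideanSpace ℝ (Fin 3) ≃ₗᵢ[ℝ] EuclideanSpace ℝ (Fin 3)) :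
    HasTypeITimeDecay C (fun t x => Q.symm (w t (Q x))) := by
  intro t ht x
  rw [LinearIsometryEquiv.norm_map]
  exact h t ht (Q x)

/-- **Near-identity, slowly rotated (about any axis) discretely self-similar profiles of the Albritton–Barker class have no
final-slice singular point, wherever the centre is.**  For every `C` and `M < ⊤` there are `Λ > 1`, `α₁ > 0` such that
every smooth profile `(w, q, H)` of the class (suitable weak on the slab, weak gradient, `𝐈 ≤ M`, rate `C`, classical on
`(−∞,0)`) invariant a.e. on the slab under `(t,x) ↦ l R⁻¹ w(l²t, l R x + ξ)` with `R = Q R_θ Q⁻¹`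
(`(Q.symm.trans (rotZLIE θ)).trans Q`, the rotation by `θ` about the axis `Q e₃`), `1 < l < Λ`, `|θ| ≤ α₁ log l` and any
`ξ`, is regular at every `(0, y)`.  Reduction to the axis `e₃` (`satelliteExclusion_nearIdentity_rotZ`) by the conjugate
profile `Q⁻¹ w(t, Q x)`. [cite: ChaeWolf2017RemovingDSS, Thms 1.1, 1.3; PineauVicol2026, Thm 1.7 (i); MajdaBertozziCUP2002, Prop. 1.1 (iii)] -/
theorem satelliteExclusion_nearIdentity_axis :
    ∀ (C : ℝ) (M : ℝ≥0∞), M < ⊤ → ∃ Λ α₁ : ℝ, 1 < Λ ∧ 0 < α₁ ∧ ∀ (l θ : ℝ)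
      (Q : EuclideanSpace ℝ (Fin 3) ≃ₗᵢ[ℝ] EuclideanSpace ℝ (Fin 3)), 1 < l → l < Λ → |θ| ≤ α₁ * Real.log l →
      ∀ (w : ℝ → EuclideanSpace ℝ (Fin 3) → EuclideanSpace ℝ (Fin 3)) (q : ℝ → EuclideanSpace ℝ (Fin 3) → ℝ)
        (H : ℝ → EuclideanSpace ℝ (Fin 3) → EuclideanSpace ℝ (Fin 3) →L[ℝ] EuclideanSpace ℝ (Fin 3))
        (ξ : EuclideanSpace ℝ (Fin 3)),
        IsSuitableWeakSolutionOn (slab (EuclideanSpace ℝ (Fin 3)) (Set.Iio 0) isOpen_Iio) 1 0 w q →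
        HasWeakSpatialGradientOn (slab (EuclideanSpace ℝ (Fin 3)) (Set.Iio 0) isOpen_Iio) w H →
        typeIBound (Set.Iio (0 : ℝ) ×ˢ Set.univ) w q H ≤ M →
        HasTypeITimeDecay C w →
        IsClassicalNSSolutionOn (Set.Iio 0) 1 0 w q →
        (fun z : ℝ × EuclideanSpace ℝ (Fin 3) =>
            l • ((Q.symm.trans (rotZLIE θ)).trans Q).symm
              (w (l ^ 2 * z.1) (l • ((Q.symm.trans (rotZLIE θ)).trans Q) z.2 + ξ)))
          =ᵐ[volume.restrict (Set.Iio (0 : ℝ) ×ˢ Set.univ)] (fun z : ℝ × EuclideanSpace ℝ (Fin 3) => w z.1 z.2) →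
        ∀ y : EuclideanSpace ℝ (Fin 3), ¬ IsBackwardSingularPoint w ((0 : ℝ), y) := by
  intro C M hM
  obtain ⟨Λ, α₁, hΛ, hα₁, hmain⟩ := satelliteExclusion_nearIdentity_rotZ C M hM
  refine ⟨Λ, α₁, hΛ, hα₁, fun l θ Q hl hlΛ hθ w q H ξ hsw hwg hI hdec hcl hae y hsing => ?_⟩
  have hl0 : 0 < l := zero_lt_one.trans hl
  set Rθ : EuclideanSpace ℝ (Fin 3) ≃ₗᵢ[ℝ] EuclideanSpace ℝ (Fin 3) := (Q.symm.trans (rotZLIE θ)).trans Q with hRθ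
  have hRθa : ∀ x, Rθ x = Q (rotZ θ (Q.symm x)) := fun x => rfl
  have hRθs : ∀ x, Rθ.symm x = Q (rotZ (-θ) (Q.symm x)) := fun x => rfl
  -- pointwise clause for `w`
  have hpt : ∀ t < (0 : ℝ), ∀ x : EuclideanSpace ℝ (Fin 3), l • Rθ.symm (w (l ^ 2 * t) (l • Rθ x + ξ)) = w t x := by
    have h := rdssInvariant_pointwise_of_classical (τ := 0) Rθ ξ hcl hl0 le_rfl (by
      filter_upwards [hae] with z hz
      simpa only [add_zero] using hz)
    intro t ht x
    simpa only [add_zero] using h t ht x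
  -- ## the conjugate profile `v = Q⁻¹ w(t, Q x)` and its class data (rotation covariance of the class)
  set v : ℝ → EuclideanSpace ℝ (Fin 3) → EuclideanSpace ℝ (Fin 3) := fun t x => Q.symm (w t (Q x)) with hv
  have hsw' := isSuitableWeakSolutionOn_conj hsw Q.symm
  have hwgv := hasWeakSpatialGradientOn_conj hwg Q.symm
  have hI' := LIE.typeIBound_lowerHalf_conj Q.symm w q H
  have hcl' := hcl.conj_linearIsometryEquiv Q.symm (uniqueDiffOn_Iio 0)
  have hf : (fun t x => Q.symm ((0 : ℝ → EuclideanSpace ℝ (Fin 3) → EuclideanSpace ℝ (Fin 3)) t (Q.symm.symm x))) = 0 := by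
    funext t x; simp
  rw [hf] at hsw' hcl'
  simp only [LinearIsometryEquiv.symm_symm] at hsw' hwgv hI' hcl'
  have hswv : IsSuitableWeakSolutionOn (slab (EuclideanSpace ℝ (Fin 3)) (Iio 0) isOpen_Iio) 1 0 v
      (fun t x => q t (Q x)) := hsw'
  have hIv : typeIBound (Iio (0 : ℝ) ×ˢ univ) v (fun t x => q t (Q x))
      (fun t x => (Q.symm : EuclideanSpace ℝ (Fin 3) →L[ℝ] EuclideanSpace ℝ (Fin 3)).comp
        ((H t (Q x)).comp (Q : EuclideanSpace ℝ (Fin 3) →L[ℝ] EuclideanSpace ℝ (Fin 3)))) ≤ M := by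
    rw [hv, hI']
    exact hI
  have hdecv : HasTypeITimeDecay C v := hasTypeITimeDecay_conj_symm hdec Q
  have hclv : IsClassicalNSSolutionOn (Set.Iio 0) 1 0 v (fun t x => q t (Q x)) := hcl'
  -- the conjugate is invariant under the `e₃`-screw similarity with translation part `Q⁻¹ ξ`, pointwise on `t < 0`
  have hptv : ∀ t < (0 : ℝ), ∀ x : EuclideanSpace ℝ (Fin 3),
      l • (rotZLIE θ).symm (v (l ^ 2 * t) (l • rotZLIE θ x + Q.symm ξ)) = v t x := by
    intro t ht x
    simp only [hv, rotZLIE_apply, rotZLIE_symm_apply]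
    have key := hpt t ht (Q x)
    rw [hRθs, hRθa, LinearIsometryEquiv.symm_apply_apply] at key
    -- `key : l • Q (rotZ (-θ) (Q.symm (w (l²t) (l • Q (rotZ θ x) + ξ)))) = w t (Q x)`
    have e : Q (l • rotZ θ x + Q.symm ξ) = l • Q (rotZ θ x) + ξ := by
      rw [map_add, LinearIsometryEquiv.apply_symm_apply, map_smul]
    rw [e, ← key, LinearIsometryEquiv.map_smul, LinearIsometryEquiv.symm_apply_apply]
  have haev : (fun z : ℝ × EuclideanSpace ℝ (Fin 3) => l • (rotZLIE θ).symm (v (l ^ 2 * z.1) (l • rotZLIE θ z.2 + Q.symm ξ)))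
      =ᵐ[volume.restrict (Set.Iio (0 : ℝ) ×ˢ Set.univ)] (fun z : ℝ × EuclideanSpace ℝ (Fin 3) => v z.1 z.2) :=
    ae_restrict_of_forall_mem (measurableSet_Iio.prod MeasurableSet.univ) fun z hz => hptv z.1 hz.1 z.2
  -- ## the `e₃`-axis theorem for the conjugate, at the point `Q⁻¹ y`
  have hreg := hmain l θ hl hlΛ hθ v _ _ (Q.symm ξ) hswv hwgv hIv hdecv hclv haev (Q.symm y)
  -- transport the singularity of `(0, y)` for `w` to `(0, Q⁻¹ y)` for `v`
  apply hreg
  intro r hr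
  have h := eLpNorm_top_parabolicCylinder_conj Q r 0 (Q.symm y) w
  rw [LinearIsometryEquiv.apply_symm_apply] at h
  rw [hv, h]
  exact hsing r hr

end Summit.NavierStokesRegularity.NavierStokesRegularity.Theorems.SymmetryModuliCountForcedSymmetry

end
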